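import Literature.Claims.NS.Muriel2010
import Literature.Analysis.FluidPDE.VorticityStretching
import HarnessLib

/-!
# C49 `Muriel2010` — the pressure recipe (16)–(17) at the abstract grain is false (`¬ Step_3Abs`)

NS-claims map (D-0090), row C49: A. Muriel, *An Exact Solution of the 3-D Navier-Stokes Equation*,
arXiv:1011.6630v1 (2010). KERNEL AUTHOR: ns-claims-typist-1 g2 (kill kit
`claims/Muriel2010/KillKit-notStep3Abs-typist1.lean` b6ddda333a3815d3, witness suggested by
ns-claims-typist-8 g2); ADOPTED by the refuter of record ns-claims-refuter-1 with only this header,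
one docstring and line-wrapping changed (kit-pool convention, C37 precedent); filed unchanged by
the salvage lane under convention (b).

`Literature.Claims.NS.Muriel2010.Step_3Abs` (skeleton p481582) types the paper's prescription
«evaluate the right-hand side of NSE in Eq. (16) and find the gradient of the pressure … (17) which
is simply NSE written in a form that reflects the above-mentioned philosophical shift … The
pressure itself in the x-direction may be found by simply integrating the x-gradient» (pp.31–32,
36) as a rule for ALL smooth divergence-free fields: the NS residual `νΔu − (u·∇)u − ∂ₜu` is
always a gradient. COUNTERMODEL: the shear ramp `u(t, x) = t·x₁·e₀` — smooth, divergence-free,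
`Δu = 0`, `(u·∇)u = 0`, `∂ₜu = x₁ e₀`, so the residual is `G(x) = −x₁ e₀`, which is not a
gradient (`∂₁G₀ = −1 ≠ 0 = ∂₀G₁`): a potential `Q` would be constant along `e₁` (since
`∂₁Q = 0`) and satisfy `Q(a + e₀) − Q(a) = −a₁`, giving
`0 = Q(e₀) − Q(0) = Q(e₀ + e₁) − Q(e₁) = −1`. This is the row's in-text kernel record
(HYGIENE-13 companion of Step 3); the row's locator of record is the STATEMENT / bridge (wrong
problem), see the VERDICT. [cite: Muriel2010, (16)–(17) pp.31–32;
p.36] All statements proved; axioms `propext`, `Classical.choice`, `Quot.sound`.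

WHAT THIS IS NOT: not a claim about NS regularity or blow-up; not a claim about any author beyond
the typed locator.
-/

noncomputable section

open Set InnerProductSpace
open Literature.Analysis.FluidPDE Literature.Claims.NS.Muriel2010
open scoped RealInnerProductSpace Laplacian ContDiff

-- The summit's canonical theorem namespace repeats the summit name (single-conjunct summit).
set_option linter.dupNamespace false

namespace Summit.NavierStokesRegularity.NavierStokesRegularity.Theorems.Muriel2010

/-- Standard basis vector `e_j` of `ℝ³`. -/
private abbrev bv (j : Fin 3) : R3 := EuclideanSpace.single j (1 : ℝ)

/-- Coordinate functional `x ↦ x j`. -/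
private abbrev pr (j : Fin 3) : R3 →L[ℝ] ℝ := EuclideanSpace.proj j

/-- The shear ramp `u(t, x) = (t·x₁) e₀`. -/
def shearRamp (t : ℝ) (x : R3) : R3 := (t * x 1) • bv 0

/-- The space derivative of the shear ramp: the rank-one map `v ↦ (t·v₁) e₀`. -/
private theorem hasFDerivAt_shearRamp (t : ℝ) (x : R3) :
    HasFDerivAt (shearRamp t) ((t • pr 1).smulRight (bv 0)) x := by
  have h : HasFDerivAt (fun y : R3 => t * y 1) (t • pr 1) x := by
    simpa using ((pr 1).hasFDerivAt (x := x)).const_mul t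
  exact h.smul_const (bv 0)

/-- The space derivative of the shear ramp as a `fderiv` identity. -/
private theorem fderiv_shearRamp (t : ℝ) :
    fderiv ℝ (shearRamp t) = fun _ => (t • pr 1).smulRight (bv 0) :=
  funext fun x => (hasFDerivAt_shearRamp t x).fderiv

/-- The shear ramp is smooth on `ℝ³ × [0,∞)` (indeed everywhere). -/
theorem shearRamp_smooth : IsSmoothOnHalfSpace shearRamp := by
  have e : Function.uncurry shearRamp = fun p : ℝ × R3 => (p.1 * p.2 1) • bv 0 := by
    funext p; rfl
  have h1 : ContDiff ℝ ∞ (fun p : ℝ × R3 => p.1 * p.2 1) :=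
    contDiff_fst.mul ((pr 1).contDiff.comp contDiff_snd)
  have h : ContDiff ℝ ∞ (Function.uncurry shearRamp) := by
    rw [e]; exact h1.smul contDiff_const
  exact h.contDiffOn

/-- The shear ramp is divergence-free at every time. -/
theorem shearRamp_divFree (t : ℝ) : NSWave0.IsDivFree (shearRamp t) := by
  intro x
  rw [NSWave0.divergence, fderiv_shearRamp, trace_eq_sum_coord, Fin.sum_univ_three]
  simp

/-- The NS residual (16) of the shear ramp is `−x₁ e₀` (for every `ν`, `t ≥ 0`). -/
theorem residual_shearRamp (ν t : ℝ) (ht : 0 ≤ t) (x : R3) :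
    Literature.Claims.NS.Muriel2010.residual ν shearRamp t x = -((x 1) • bv 0) := by
  -- time derivative within `[0,∞)`
  have h1 : derivWithin (fun s => shearRamp s x) (Ici 0) t = (x 1) • bv 0 := by
    have hd : HasDerivAt (fun s : ℝ => shearRamp s x) ((x 1) • bv 0) t := by
      have := ((hasDerivAt_id t).mul_const (x 1)).smul_const (bv 0)
      simpa [shearRamp] using this
    exact hd.hasDerivWithinAt.derivWithin (uniqueDiffOn_Ici 0 t ht)
  -- convective term vanishes
  have h2 : fderiv ℝ (shearRamp t) x (shearRamp t x) = 0 := by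
    rw [fderiv_shearRamp]
    simp [shearRamp]
  -- Laplacian of a linear field vanishes
  have h3 : (Δ (shearRamp t)) x = 0 := by
    rw [InnerProductSpace.laplacian_eq_iteratedFDeriv_stdOrthonormalBasis]
    simp [iteratedFDeriv_two_apply, fderiv_shearRamp]
  simp only [Literature.Claims.NS.Muriel2010.residual, h1, h2, h3, smul_zero, sub_zero,
    zero_sub]

/-- A smooth-on-the-half-space pressure has differentiable time slices. [folklore] -/
private theorem differentiable_slice {P : ℝ → R3 → ℝ} (hP : IsSmoothOnHalfSpace P) {t : ℝ}
    (ht : 0 ≤ t) : Differentiable ℝ (P t) := by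
  have hmap : MapsTo (fun x : R3 => (t, x)) univ (Ici (0 : ℝ) ×ˢ (univ : Set R3)) :=
    fun x _ => ⟨ht, mem_univ _⟩
  have hc : ContDiffOn ℝ ∞ (fun x : R3 => Function.uncurry P (t, x)) univ :=
    hP.comp (contDiff_prodMk_right t).contDiffOn hmap
  have : ContDiff ℝ ∞ (P t) := by
    simpa [Function.uncurry, contDiffOn_univ] using hc
  exact this.differentiable (by simp)

/-- Line derivative of a potential: if `∇Q = G` then `s ↦ Q(a + s v)` has derivative
`⟪G(a+sv), v⟫`. -/
private theorem hasDerivAt_line {Q : R3 → ℝ} (hQ : Differentiable ℝ Q) (a v : R3) (s : ℝ) :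
    HasDerivAt (fun s : ℝ => Q (a + s • v)) ⟪gradient Q (a + s • v), v⟫ s := by
  have hl : HasDerivAt (fun s : ℝ => a + s • v) v s := by
    simpa using ((hasDerivAt_id s).smul_const v).const_add a
  have h : HasDerivAt (fun s : ℝ => Q (a + s • v)) (fderiv ℝ Q (a + s • v) v) s :=
    (hQ (a + s • v)).hasFDerivAt.comp_hasDerivAt s hl
  have e : fderiv ℝ Q (a + s • v) v = ⟪gradient Q (a + s • v), v⟫ := by
    rw [gradient, ← toDual_apply_apply, (toDual ℝ R3).apply_symm_apply]
  rwa [e] at h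

/-- **KILL: `¬ Step_3Abs`.** The pressure recipe (16)–(17) as a rule for smooth divergence-free
fields fails for the shear ramp: its residual `−x₁ e₀` is not a gradient. -/
theorem not_Step_3Abs : ¬ Literature.Claims.NS.Muriel2010.Step_3Abs := by
  intro h
  obtain ⟨P, hP, hrec⟩ := h 1 one_pos shearRamp shearRamp_smooth (fun t _ => shearRamp_divFree t)
  -- the slice `Q = P 0` is differentiable with `∇Q(x) = −x₁ e₀`
  set Q : R3 → ℝ := P 0 with hQdef
  have hQ : Differentiable ℝ Q := differentiable_slice hP le_rfl
  have hgrad : ∀ x : R3, gradient Q x = -((x 1) • bv 0) := fun x => by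
    rw [hQdef, hrec 0 le_rfl x, residual_shearRamp 1 0 le_rfl x]
  -- (i) `Q` is constant along `e₁`
  have hconst1 : ∀ (a : R3) (s : ℝ), Q (a + s • bv 1) = Q a := by
    intro a s
    have hd : ∀ r : ℝ, deriv (fun r : ℝ => Q (a + r • bv 1)) r = 0 := fun r => by
      rw [(hasDerivAt_line hQ a (bv 1) r).deriv, hgrad]
      simp [EuclideanSpace.inner_single_right]
    have hdiff : Differentiable ℝ (fun r : ℝ => Q (a + r • bv 1)) := fun r =>
      (hasDerivAt_line hQ a (bv 1) r).differentiableAt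
    simpa using is_const_of_deriv_eq_zero hdiff hd s 0
  -- (ii) along `e₀`: `Q(a + s e₀) − Q(a) = −a₁ s`
  have hlin0 : ∀ (a : R3) (s : ℝ), Q (a + s • bv 0) = Q a - a 1 * s := by
    intro a s
    have hd : ∀ r : ℝ, deriv (fun r : ℝ => Q (a + r • bv 0) + a 1 * r) r = 0 := fun r => by
      have h1 := hasDerivAt_line hQ a (bv 0) r
      have h2 : HasDerivAt (fun r : ℝ => a 1 * r) (a 1) r := by
        simpa using (hasDerivAt_id r).const_mul (a 1)
      have h12 : HasDerivAt (fun r : ℝ => Q (a + r • bv 0) + a 1 * r)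
          (⟪gradient Q (a + r • bv 0), bv 0⟫ + a 1) r := h1.add h2
      rw [h12.deriv, hgrad]
      simp [EuclideanSpace.inner_single_right, inner_neg_left]
    have hdiff : Differentiable ℝ (fun r : ℝ => Q (a + r • bv 0) + a 1 * r) := fun r =>
      ((hasDerivAt_line hQ a (bv 0) r).add
        (by simpa using (hasDerivAt_id r).const_mul (a 1))).differentiableAt
    have := is_const_of_deriv_eq_zero hdiff hd s 0
    simp at this
    linarith
  -- combine: 0 = Q(e₀) − Q(0) but also Q(e₁ + e₀) − Q(e₁) = −1 with Q(e₁ + e₀) = Q(e₀),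
  -- Q(e₁) = Q(0)
  have hA : Q (bv 0) = Q 0 := by
    have := hlin0 0 1
    simpa using this
  have hB : Q (bv 1 + bv 0) = Q (bv 1) - 1 := by
    have := hlin0 (bv 1) 1
    simpa [PiLp.single_apply] using this
  have hC : Q (bv 1 + bv 0) = Q (bv 0) := by
    have := hconst1 (bv 0) 1
    simpa [add_comm] using this
  have hD : Q (bv 1) = Q 0 := by
    have := hconst1 0 1
    simpa using this
  linarith [hA, hB, hC, hD]

end Summit.NavierStokesRegularity.NavierStokesRegularity.Theorems.Muriel2010

end

-- WHAT THIS IS NOT: not a claim about NS regularity or blow-up; not a claim about any author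
-- beyond the typed locator.
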